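import Summits.HodgeConjecture.HodgeConjecture.Theorems.SiuRepresentabilitySectorGlue

/-!
# Route SiuRepresentability — `Assembly` (assembly item stmt-HodgeConjecture-13797)

The assembly item of route `SiuRepresentability`,

  SiuTransfer → KaehlerRepresentable → LefschetzOneOne → HardLefschetzReduction → SectorComplement →
    HodgeConjecture,

is the route's deciding theorem `closes` (which also takes `SectorGlue`) with `SectorGlue` discharged
by the tree's `siuRepresentability_sectorGlue_proof` (pure logic, file `SiuRepresentabilitySectorGlue`).
No named-fact hypothesis, no sorry.
-/

-- `Summit.HodgeConjecture.HodgeConjecture.Theorems` is the mandated namespace (single-problem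
-- summit: Problem = Summit), which `linter.dupNamespace` flags on every declaration; the lakefile
-- turns the linter off tree-wide (weak option), restated here so stand-alone elaboration is
-- warning-free too.
set_option linter.dupNamespace false

namespace Summit.HodgeConjecture.HodgeConjecture.Theorems

/-- **Item stmt-HodgeConjecture-13797 (`Assembly`), route `SiuRepresentability`**: the deciding
theorem `closes` with its glue hypothesis `SectorGlue` discharged by
`siuRepresentability_sectorGlue_proof`.  The type is the route decl
`Summit.HodgeConjecture.HodgeConjecture.Theses.SiuRepresentability.Assembly`. [cite: Siu1980, Thm. 1] -/
theorem siuRepresentability_assembly_proof :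
    Summit.HodgeConjecture.HodgeConjecture.Theses.SiuRepresentability.Assembly :=
  fun hS hR hL hH hC ↦ Summit.HodgeConjecture.HodgeConjecture.Theses.SiuRepresentability.closes
    hS hR hL hH siuRepresentability_sectorGlue_proof hC

end Summit.HodgeConjecture.HodgeConjecture.Theorems
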